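import Literature.MathematicalPhysics.QuantumFieldTheory.Balaban1983to89.B1Ineq238RegularRegion
import Literature.MathematicalPhysics.QuantumFieldTheory.Balaban1983to89.B1Prop23RegularRegionSmall

/-!
# `Balaban1983to89.B1Ineq238RegularRegionSmall` — T. Bałaban, *(Higgs)₂,₃ quantum fields in a finite volume. I. A lower bound*,
# Commun. Math. Phys. **85** (1982) 603–626 [Balaban1982Higgs1], PROPOSITION 2.3 (2.37)–(2.38) p. 612 AT A REGULAR `A ≠ 0` FOR NESTED
# PRINTED REGIONS `Ω = B^k(Λ_k) ⊆ Ω₀ = B^k(Λ⁰_k)`, **ONE SMALLNESS PARAMETER `L^kδ_A·|e|`**, and the whole of Proposition 2.3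
# ((2.34), (2.36) for `Ω` and for `Ω₀`, and (2.38)) for a nested pair with ONE set of constants — the `_small` twin of r14 g14's
# `B1Ineq238RegularRegion.prop23_238_regular_region` (whose smallness is packaged as `e² ≦ E₀` AND `L^kδ_A ≦ c|e|`), asked for by
# r14 g18's design of the [B3] (2.5) programme (`lit-balaban-r14/DESIGN-B3-25-regular-nested.md` §3/§5: *"a `_small` twin is a
# 40-line copy with `lower_supported_regular_region_small` if wanted"*, *"p35's or r14's lane"*)

statement-level skeleton of published theorems with citation tags; proofs where landed; nothing here is a claim about the Yang–Mills mass gap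

PDF held: `paper:balaban1982-cmp85-higgs23-i` (journal page = PDF page + 602), p. 612 [PDF 10] (2.36)–(2.38), p. 611 [PDF 9] Prop. 2.3,
p. 610 [PDF 8] (2.23) and Prop. 2.1; [Balaban1983RegularityDecay] = `paper:balaban1983-cmp89-regularity-decay` pp. 593–594 [PDF 23–24]
Sect. 5 (5.4)–(5.6).

CITATION HEADER (lean-in-tree rule).  Cell `lit-balaban` (HOME `run/shared/lean/pub/lit-balaban/`), PHASE-2 proof seat **p35** gen 17
(unit `lit-balaban-p35`; free target under ruling G.5-34(d), TAKING line HOME/STATUS.md 2026-08-22T23:3xZ).  SKELETON row **B1.Prop2.3**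
(owner r14; decls of record `B1.Prop23Literal`/`B1.Prop23Intended`; concrete-carrier members r14 g9 (`A = 0`), r14 g13 (torus, one
smallness parameter), r14 g14 `B1Prop23RegularRegion`/`B1Ineq238RegularRegion` (regions / nested regions, `(E₀, c)` packaging), p35
g16 `B1Prop23RegularRegionSmall` (regions, one smallness parameter)) — THIS file: a MEMBER, the nested-regions (2.38) with the single
smallness parameter, and the joint form.  USED BY NAME, never restated: r14 g14 `B1Ineq238RegularRegion.ineq238_regular_region_of` (the
two-operator Sect.-5 engine with scale transfer), `B1Prop23RegularRegion.hker_regular_region_uniform` ((5.4) at a regular `A`),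
`B1Ineq229RegularRegion.ineq229_regular_region_distC` (the localisation (5.5) = (2.29)), p35 g16 `B1Prop23RegularRegionSmall.
{lower_supported_regular_region_small, prop23_regular_region_small}`, r14 g7 `B1Ineq234Concrete.{profile, nCol, distC, distC_nonneg}`,
`B1Ineq234LevelZero.distC_le_tdist_add`, p15 `B2Eq328ConcretePieces.pieceF`, `B2Prop31ZeroFieldConcrete.mem_pieceF_iff`,
`B2Eq337ScalarIntegration.Regions`, pv09/b04 `B4Sect5Torus.{cSt, dSt, cSt_pos, dSt_pos, profile_nonneg}`.

WHAT IS PRINTED (verbatim, [B1] p. 611 [PDF 9] l. 31–33 and p. 612 [PDF 10] l. 4–8): *"Proposition 2.3. If a configuration A is regular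
on Ω in the sense defined in Proposition 2.1, then there exist positive constants δ₀, c₀, γ₀, γ₁ dependent on d and a, and independent
of A, k, Ω and Λ, such that"* [(2.33)–(2.36)] *"Similarly for Ω ⊂ Ω₀ and δC^{(k)}_Λ(Ω, Ω₀, A) = C^{(k)}_Λ(Ω, A) − C^{(k)}_Λ(Ω₀, A), (2.37)
we have |δC^{(k)}_Λ(Ω, Ω₀, A; x, x′)| ≦ c₀exp(−δ₀(|x − x′| + dist(x, Ω^{(k)c}) + dist(x′, Ω^{(k)c}))), x, x′ ∈ Λ. (2.38)"*; p. 610 Prop. 2.1: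
*"… for e(L^kε) sufficiently small"*, (2.23) *"|(∂^η_μA)(x)| ≦ c(e(L^kε))^{β−1}, x ∈ Ω"*.

DICTIONARY.  As in `B1Ineq238RegularRegion`: `Ω^{(k)} = Λ_k ↦ R.block j`, `Ω₀^{(k)} = Λ⁰_k ↦ R₀.block j` (two region towers on the
same torus with `R.block j ⊆ R₀.block j`, `k = j + 1`), `Ω ↦ pieceF R j`, `Ω₀ ↦ pieceF R₀ j`, `C^{(k)}_Λ(Ω, A) ↦ condCov232 C (pieceF R j) A
m² a k Λ` (in `L^kε`-units), `dist(x, Ω^{(k)c}) ↦ distC (R.block j)`; «A regular» ↦ one-step differences `≦ δ_A` on `Ω₀`; the smallness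
«e(L^kε) sufficiently small» ↦ the ONE condition `L^kδ_A·|e| ≦ t₀` (for the (2.23) currency `L^kδ_A ≦ c|e|`, `e² ≦ E₀`: `L^kδ_A·|e| ≦
ce² ≦ t₀` — r14's `prop23_238_regular_region` is the regime `E₀ = t₀/(c + 1)`; it is NOT re-derived here).

WHAT THIS FILE PROVES (kernel-checked, zero `sorry`, theorems only; axioms standard).
* §1 **`prop23_238_regular_region_small`** — (2.38) AT A REGULAR `A ≠ 0` FOR NESTED PRINTED REGIONS, ONE SMALLNESS PARAMETER: for
  `d`, `L > 1`, `a, m² > 0`, `N` there are `t₀, c₁, δ₁ > 0` (functions of `d, L, a, m², N` only) such that for EVERY charge, every torus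
  of the model with these `d, L`, every pair of region towers `R, R₀` (`K ≦ K_P`) with `R.block j ⊆ R₀.block j` both unions of blocks,
  every level `1 ≦ k = j + 1 < K_P` with `L^kε ≦ 1`, EVERY `A` with one-step differences `≦ δ_A` on `Ω₀ = B^k(Λ⁰_k)` and the ONE
  condition `L^kδ_A·|e| ≦ t₀`, every `Λ ⊂ Λ_k` and all `p = (x, i)`, `q = (x′, i′)` over `Λ`:
  `|(C^{(k),L^kε}_Λ(Ω, A) − C^{(k),L^kε}_Λ(Ω₀, A))(p, q)| ≦ (L^kε)²c₁e^{−δ₁(|x − x′| + dist(x, Λ_kᶜ) + dist(x′, Λ_kᶜ))}`.  Proof =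
  r14 g14's proof of `prop23_238_regular_region` verbatim, the (2.33)ₗ block fed by p35 g16's `lower_supported_regular_region_small`
  (for `Ω` and for `Ω₀`) and the Cor.-2.3 smallness `d²·ε|e|·L^{2k}·δ_A ≦ 1/3` of the (5.4)/(5.5) inputs taken from
  `L^kδ_A|e| ≦ t₀ ≦ 1/(3(d² + 1))`, `L^kε ≦ 1`.
* §2 **`prop23_nested_regular_region_small`** — PROPOSITION 2.3 FOR A NESTED PAIR WITH ONE SET OF CONSTANTS, one smallness parameter:
  `t₀, c₁, δ₁ > 0` such that, under the same hypotheses, for every `Λ ⊂ Λ_k` and `p, q` over `Λ`: (2.34) and (2.36) for `C^{(k)}_Λ(Ω, A)`,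
  (2.34) and (2.36) for `C^{(k)}_Λ(Ω₀, A)`, and (2.38) — all with the same `(c₁, δ₁)` (the print's one set of constants «independent of
  A, k, Ω and Λ»; joins §1 with `prop23_regular_region_small` for `R` and for `R₀`, constants merged by the private `kernelBound_weaken`).
HONEST SCOPE / DIVERGENCE.  (i) A re-assembly of r14 g14's engine and inputs with p35 g16's one-parameter (2.33)ₗ — no new analysis;
constants crude, depending on `(d, N, L, a, m²)` (WEAKER than the printed *"dependent on d and a"*); (ii) both `Λ_k` and `Λ⁰_k` unions
of blocks, `Λ ⊂ Λ_k` arbitrary, regularity of `A` asked on the LARGER region `Ω₀`; (iii) the single condition `L^kδ_A·|e| ≦ t₀` is the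
print's *"for e(L^kε) sufficiently small"* in the (2.23) currency, with no separate bound on `e` or on `L^kδ_A/|e|`; (iv) METHOD of the
inputs: Combes–Thomas / energy comparison (r14), not the print's random walk; (v) NOT summit progress.
-/

noncomputable section

open scoped BigOperators InnerProductSpace Matrix

namespace Literature.MathematicalPhysics.QuantumFieldTheory.Balaban1983to89.B1Ineq238RegularRegionSmall

open HiggsLattice HiggsAveraging HiggsCovariance HiggsCovariancePos B1Eq230FluctCov HiggsCondCov232
open B4Sect5Torus (cSt dSt cSt_pos dSt_pos profile_nonneg)
open B2Eq337ScalarIntegration (Regions)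
open B2Eq328ConcretePieces (pieceF)
open B2Prop31ZeroFieldConcrete (mem_pieceF_iff)
open B1Ineq234Concrete (profile nCol distC distC_nonneg)
open B1Ineq234LevelZero (distC_le_tdist_add)
open B1Prop23RegularRegion (hker_regular_region_uniform)
open B1Ineq229RegularRegion (ineq229_regular_region_distC)
open B1Ineq238RegularRegion (ineq238_regular_region_of)
open B1Prop23RegularRegionSmall (lower_supported_regular_region_small prop23_regular_region_small)
open Matrix

variable {P : HiggsLattice.Params} {N : ℕ}

/-! ## §0 Helpers -/

section Helpers

/-- The Cor.-2.3 smallness `d²·(ε|e|)·(L^k)²·δ_A ≦ 1/3` of the (5.4)/(5.5) inputs from the one-parameter condition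
`L^kδ_A·|e| ≦ 1/(3(d² + 1))` and `L^kε ≦ 1` (as in `B1Prop23RegularRegionSmall.prop23_regular_region_small`).
[cite: Balaban1982Higgs1, Prop. 2.1 (2.23) p.610] -/
theorem cor23_smallness_of_small (C : ChargeData N) {k : ℕ} (hs : P.mesh k ≤ 1) {δA : ℝ} (hδA : 0 ≤ δA)
    (ht3 : (P.L : ℝ) ^ k * δA * |C.e| ≤ 1 / (3 * ((P.d : ℝ) ^ 2 + 1))) :
    (P.d : ℝ) ^ 2 * (P.mesh 0 * |C.e|) * ((P.L : ℝ) ^ k) ^ 2 * δA ≤ 1 / 3 := by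
  have hmesh : P.mesh k = (P.L : ℝ) ^ k * P.mesh 0 := by
    unfold HiggsLattice.Params.mesh; ring
  have hu0 : 0 ≤ (P.L : ℝ) ^ k * δA * |C.e| := by positivity
  have h1 : (P.d : ℝ) ^ 2 * (P.mesh 0 * |C.e|) * ((P.L : ℝ) ^ k) ^ 2 * δA
      = (P.d : ℝ) ^ 2 * (P.mesh k * ((P.L : ℝ) ^ k * δA * |C.e|)) := by
    rw [hmesh]; ring
  rw [h1]
  have h2 : P.mesh k * ((P.L : ℝ) ^ k * δA * |C.e|) ≤ 1 * (1 / (3 * ((P.d : ℝ) ^ 2 + 1))) :=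
    mul_le_mul hs ht3 hu0 zero_le_one
  have h3 : (P.d : ℝ) ^ 2 * (1 * (1 / (3 * ((P.d : ℝ) ^ 2 + 1)))) ≤ 1 / 3 := by
    rw [one_mul, mul_one_div, div_le_div_iff₀ (by positivity) (by norm_num)]
    nlinarith [sq_nonneg (P.d : ℝ)]
  exact (mul_le_mul_of_nonneg_left h2 (sq_nonneg _)).trans h3

/-- Weakening of a kernel bound `m·c·e^{−δs}` in the constants: `c ≦ c′`, `δ′ ≦ δ`, for `m, c, s ≧ 0`. [folklore] -/
private theorem kernelBound_weaken {m c c' δ δ' s x : ℝ} (hm : 0 ≤ m) (hc : 0 ≤ c) (hcc : c ≤ c') (hδδ : δ' ≤ δ) (hs : 0 ≤ s)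
    (h : x ≤ m * c * Real.exp (-(δ * s))) : x ≤ m * c' * Real.exp (-(δ' * s)) := by
  refine h.trans (mul_le_mul (mul_le_mul_of_nonneg_left hcc hm) (Real.exp_le_exp.mpr (by nlinarith))
    (Real.exp_pos _).le (mul_nonneg hm (hc.trans hcc)))

end Helpers

/-! ## §1 (2.38) at a regular `A` for nested printed regions, one smallness parameter -/

section Printed

/-- **[B1] PROPOSITION 2.3 (2.37)–(2.38) AT A REGULAR `A ≠ 0` FOR NESTED PRINTED REGIONS, ONE SMALLNESS PARAMETER** (p. 612
*"Similarly for Ω ⊂ Ω₀ and δC^{(k)}_Λ(Ω, Ω₀, A) = C^{(k)}_Λ(Ω, A) − C^{(k)}_Λ(Ω₀, A), (2.37) we have |δC^{(k)}_Λ(Ω, Ω₀, A; x, x′)| ≦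
c₀exp(−δ₀(|x − x′| + dist(x, Ω^{(k)c}) + dist(x′, Ω^{(k)c}))), x, x′ ∈ Λ. (2.38)"*; Prop. 2.1 p. 610 *"for e(L^kε) sufficiently small"*):
for `d`, `L > 1`, `a, m² > 0` and `N` there are `t₀, c₁, δ₁ > 0` (functions of `d, L, a, m², N` only) such that for EVERY charge, every
torus of the model with these `d, L` (every volume, every `ε`), every two region towers `R, R₀` (`K ≦ K_P`) and level `1 ≦ k = j + 1 < K_P`
with `L^kε ≦ 1`, `Λ_k = R.block j ⊆ Λ⁰_k = R₀.block j` both unions of blocks, EVERY `A` with one-step differences `≦ δ_A` on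
`Ω₀ = B^k(Λ⁰_k)` and the ONE smallness condition `L^kδ_A·|e| ≦ t₀`, every `Λ ⊂ Λ_k` and all `p = (x, i)`, `q = (x′, i′)` with `x, x′ ∈ Λ`:
`|(C^{(k),L^kε}_Λ(Ω, A) − C^{(k),L^kε}_Λ(Ω₀, A))(p, q)| ≦ (L^kε)²c₁e^{−δ₁(|x − x′| + dist(x, Λ_kᶜ) + dist(x′, Λ_kᶜ))}` — `(c₁, δ₁)` INDEPENDENT
of `A`, `k`, `ε`, the volume, the charge, `Ω ⊂ Ω₀` and `Λ`.  Proof: r14 g14's `prop23_238_regular_region` verbatim with the (2.33)ₗ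
input `B1Prop23RegularRegionSmall.lower_supported_regular_region_small`.
[cite: Balaban1982Higgs1, Prop. 2.3 (2.37)–(2.38) p.612, Prop. 2.1 (2.23) p.610]
[cite: Balaban1983RegularityDecay, Sect. 5 (5.4) p.593, (5.5)–(5.6) p.594] -/
theorem prop23_238_regular_region_small (d L : ℕ) (hL1 : 1 < L) {a msq : ℝ} (ha : 0 < a) (hmsq : 0 < msq) (N : ℕ) :
    ∃ t₀ c₁ δ₁ : ℝ, 0 < t₀ ∧ 0 < c₁ ∧ 0 < δ₁ ∧
      ∀ (C : ChargeData N) (P : HiggsLattice.Params), P.d = d → P.L = L →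
      ∀ {K : ℕ} (R R₀ : Regions P K), K ≤ P.K → ∀ (j : Fin K), j.val + 1 < P.K → P.mesh (j.val + 1) ≤ 1 →
      (∀ y y' : HiggsLattice.Site P (j.val + 1),
        HiggsLattice.blockOf y = HiggsLattice.blockOf y' → (y ∈ R.block j ↔ y' ∈ R.block j)) →
      (∀ y y' : HiggsLattice.Site P (j.val + 1),
        HiggsLattice.blockOf y = HiggsLattice.blockOf y' → (y ∈ R₀.block j ↔ y' ∈ R₀.block j)) →
      R.block j ⊆ R₀.block j →
      ∀ (A : HiggsLattice.VecField P 0) {δA : ℝ}, 0 ≤ δA →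
        (∀ z ∈ pieceF R₀ j, ∀ μ' ν : Fin P.d, |A ⟨z.shift ν, μ'⟩ - A ⟨z, μ'⟩| ≤ δA) →
        (P.L : ℝ) ^ (j.val + 1) * δA * |C.e| ≤ t₀ →
        ∀ {Λ : Finset (HiggsLattice.Site P (j.val + 1))}, Λ ⊆ R.block j →
        ∀ {p q : HiggsLattice.Site P (j.val + 1) × Ix N}, p.1 ∈ Λ → q.1 ∈ Λ →
          |mat (condCov232 C (pieceF R j) A msq a (j.val + 1) Λ) p q
              - mat (condCov232 C (pieceF R₀ j) A msq a (j.val + 1) Λ) p q| ≤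
            P.mesh (j.val + 1) ^ 2 * c₁ * Real.exp (-(δ₁ *
              ((HiggsLattice.Site.tdist p.1 q.1 : ℝ) + distC (R.block j) p.1 + distC (R.block j) q.1))) := by
  obtain ⟨t₀, ht₀, γ, hγ, hlowAll⟩ := lower_supported_regular_region_small d L hL1 ha hmsq N
  have hLr : (1 : ℝ) < (L : ℝ) := by exact_mod_cast hL1
  have hinv : ((L : ℝ) ^ 2)⁻¹ < 1 := inv_lt_one_of_one_lt₀ (by nlinarith)
  have hγr : 0 < min 2 (a * (1 - ((L : ℝ) ^ 2)⁻¹) / 4) :=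
    lt_min (by norm_num) (by nlinarith [mul_pos ha (show (0:ℝ) < 1 - ((L : ℝ) ^ 2)⁻¹ by linarith)])
  have hden : (0 : ℝ) < 4 * d + 4 * a := by positivity
  -- the admissible exponent `δ₀ = γ_r/(4d + 4a)`, the kernel constants `c_U`, `c_L` (as in `prop23_238_regular_region`)
  obtain ⟨δ₀, hδ₀⟩ : ∃ δ₀ : ℝ, δ₀ = min 2 (a * (1 - ((L : ℝ) ^ 2)⁻¹) / 4) / (4 * d + 4 * a) := ⟨_, rfl⟩
  have hδ₀pos : 0 < δ₀ := by rw [hδ₀]; exact div_pos hγr hden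
  obtain ⟨cU, hcU⟩ : ∃ cU : ℝ, cU = a * ((L : ℝ) ^ 2)⁻¹ * Real.exp (δ₀ * ((L : ℝ) - 1)) +
      (a + a ^ 2 * (2 / min 2 (a * (1 - ((L : ℝ) ^ 2)⁻¹) / 4) * Real.exp δ₀)) := ⟨_, rfl⟩
  have hcUpos : 0 < cU := by rw [hcU]; positivity
  obtain ⟨cL, hcL⟩ : ∃ cL : ℝ, cL = a ^ 2 * ((Real.exp (6 * δ₀) * ((d + a / 2) * (2 / min 2 (a * (1 - ((L : ℝ) ^ 2)⁻¹) / 4)) ^ 2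
      + (min 2 (a * (1 - ((L : ℝ) ^ 2)⁻¹) / 4))⁻¹) + 4 / min 2 (a * (1 - ((L : ℝ) ^ 2)⁻¹) / 4) * Real.exp δ₀) / 2) := ⟨_, rfl⟩
  have hcLnn : 0 ≤ cL := by rw [hcL]; positivity
  have hcULpos : 0 < cU + cL := by linarith
  -- the threshold: `t₀` of the (2.33)ₗ input and `d²·t ≦ 1/3` for the Cor.-2.3 inputs
  obtain ⟨t₁, ht₁⟩ : ∃ t₁ : ℝ, t₁ = min t₀ (1 / (3 * ((d : ℝ) ^ 2 + 1))) := ⟨_, rfl⟩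
  have ht₁pos : 0 < t₁ := by rw [ht₁]; exact lt_min ht₀ (by positivity)
  refine ⟨t₁, cSt (fun t => (nCol N : ℝ) * B4Sect5Proof.latticeConst d t) γ (cU + cL) (δ₀ / 2),
    dSt (fun t => (nCol N : ℝ) * B4Sect5Proof.latticeConst d t) γ (cU + cL) (δ₀ / 2), ht₁pos, cSt_pos _ _ _ hγ,
    dSt_pos (profile_nonneg d (nCol N)) hγ hcULpos.le (by positivity), ?_⟩
  intro C P hPd hPL K R R₀ hK j hjK hs hU hU₀ hsubΛ A δA hδA hreg₀ ht Λ hΛ p q hp hq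
  have ht0' : (P.L : ℝ) ^ (j.val + 1) * δA * |C.e| ≤ t₀ := ht.trans (by rw [ht₁]; exact min_le_left _ _)
  have ht3 : (P.L : ℝ) ^ (j.val + 1) * δA * |C.e| ≤ 1 / (3 * ((d : ℝ) ^ 2 + 1)) :=
    ht.trans (by rw [ht₁]; exact min_le_right _ _)
  -- regularity on `Ω ⊆ Ω₀`
  have hsubΩ : pieceF R j ⊆ pieceF R₀ j := by
    intro x hx
    rw [mem_pieceF_iff] at hx ⊢
    exact hsubΛ hx
  have hreg : ∀ z ∈ pieceF R j, ∀ μ' ν : Fin P.d, |A ⟨z.shift ν, μ'⟩ - A ⟨z, μ'⟩| ≤ δA :=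
    fun z hz => hreg₀ z (hsubΩ hz)
  -- (2.33)ₗ in the supported form, for both operators, on the fields vanishing off `Λ_k` (one smallness parameter)
  have hlow : ∀ f : ScalarField P (j.val + 1) N, (∀ y, y ∉ R.block j → f y = 0) →
      γ * (P.mesh (j.val + 1))⁻¹ ^ 2 * siteInner f f ≤ siteInner f (precOpA C (pieceF R j) A msq a (j.val + 1) f) :=
    hlowAll C P hPd hPL R hK j hjK hs hU A hδA hreg ht0'
  have hlow₀ : ∀ f : ScalarField P (j.val + 1) N, (∀ y, y ∉ R.block j → f y = 0) →
      γ * (P.mesh (j.val + 1))⁻¹ ^ 2 * siteInner f f ≤ siteInner f (precOpA C (pieceF R₀ j) A msq a (j.val + 1) f) := by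
    intro f hf
    exact hlowAll C P hPd hPL R₀ hK j hjK hs hU₀ A hδA hreg₀ ht0' f (fun y hy => hf y (fun h => hy (hsubΛ h)))
  subst hPd hPL
  have hPL1 : 1 < P.L := hL1
  -- the Cor.-2.3 smallness from `L^kδ_A|e| ≦ 1/(3(d² + 1))`, `L^kε ≦ 1`
  have hsmall : (P.d : ℝ) ^ 2 * (P.mesh 0 * |C.e|) * ((P.L : ℝ) ^ (j.val + 1)) ^ 2 * δA ≤ 1 / 3 :=
    cor23_smallness_of_small C hs hδA ht3
  have hδ₀adm : (4 * (P.d : ℝ) + 4 * a) * δ₀ ≤ min 2 (a * (1 - ((P.L : ℝ) ^ 2)⁻¹) / 4) := by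
    rw [hδ₀]; exact le_of_eq (mul_div_cancel₀ _ hden.ne')
  -- (5.4) for both operators with the uniform constant, rate weakened to `δ₀/2`
  have hrate : ∀ t : ℝ, 0 ≤ t → Real.exp (-(δ₀ * t)) ≤ Real.exp (-(δ₀ / 2 * t)) := fun t ht =>
    Real.exp_le_exp.mpr (by nlinarith)
  have hker : ∀ p q : HiggsLattice.Site P (j.val + 1) × Ix N, p.1 ∈ R.block j → q.1 ∈ R.block j →
      |mat (precOpA C (pieceF R j) A msq a (j.val + 1)) p q| ≤
        cU * (P.mesh (j.val + 1))⁻¹ ^ 2 * Real.exp (-(δ₀ / 2 * (HiggsLattice.Site.tdist p.1 q.1 : ℝ))) := by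
    intro p q hp hq
    have h := hker_regular_region_uniform R C ha hPL1 hmsq j hjK A hreg hsmall hδ₀pos.le hδ₀adm p q hp hq
    rw [← hcU] at h
    refine h.trans (mul_le_mul_of_nonneg_left (hrate _ (Nat.cast_nonneg _)) (by positivity))
  have hker₀ : ∀ p q : HiggsLattice.Site P (j.val + 1) × Ix N, p.1 ∈ R.block j → q.1 ∈ R.block j →
      |mat (precOpA C (pieceF R₀ j) A msq a (j.val + 1)) p q| ≤
        cU * (P.mesh (j.val + 1))⁻¹ ^ 2 * Real.exp (-(δ₀ / 2 * (HiggsLattice.Site.tdist p.1 q.1 : ℝ))) := by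
    intro p q hp hq
    have h := hker_regular_region_uniform R₀ C ha hPL1 hmsq j hjK A hreg₀ hsmall hδ₀pos.le hδ₀adm p q (hsubΛ hp) (hsubΛ hq)
    rw [← hcU] at h
    refine h.trans (mul_le_mul_of_nonneg_left (hrate _ (Nat.cast_nonneg _)) (by positivity))
  -- the localisation input (5.5) = (2.29) at the regular `A`, weight `dist(·, Λ_kᶜ)`
  have hloc : ∀ p q : HiggsLattice.Site P (j.val + 1) × Ix N, p.1 ∈ R.block j → q.1 ∈ R.block j →
      |mat (deltaKA C (pieceF R j) A msq a (j.val + 1)) p q - mat (deltaKA C (pieceF R₀ j) A msq a (j.val + 1)) p q| ≤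
        cL * (P.mesh (j.val + 1))⁻¹ ^ 2 * Real.exp (-(δ₀ / 2 *
          ((HiggsLattice.Site.tdist p.1 q.1 : ℝ) + distC (R.block j) p.1 + distC (R.block j) q.1))) := by
    intro p q hp hq
    have h := ineq229_regular_region_distC C ha hPL1 hmsq j.val hjK.le (pieceF R j) (pieceF R₀ j) (R.block j) (R₀.block j)
      (mem_pieceF_iff R j) (mem_pieceF_iff R₀ j) hsubΛ A hreg₀ hsmall hδ₀pos.le hδ₀adm p q hp hq
    rw [← hcL] at h
    exact h
  exact ineq238_regular_region_of R R₀ C ha hPL1 hmsq j hjK.le hs A hγ hlow hlow₀ hcUpos hcLnn (by positivity) hker hker₀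
    (fun x => distC_nonneg _ x) (fun x y => distC_le_tdist_add _ x y) hloc hΛ hp hq

end Printed

/-! ## §2 Proposition 2.3 for a nested pair with ONE set of constants, one smallness parameter -/

section Joint

/-- **[B1] PROPOSITION 2.3 (2.34), (2.36), (2.38) FOR A NESTED PAIR `Ω ⊆ Ω₀` WITH ONE SET OF CONSTANTS, ONE SMALLNESS PARAMETER**
(p. 611 *"there exist positive constants δ₀, c₀, γ₀, γ₁ dependent on d and a, and independent of A, k, Ω and Λ, such that"* (2.33)–
(2.38)): for `d`, `L > 1`, `a, m² > 0` and `N` there are `t₀, c₁, δ₁ > 0` such that for every charge, every torus with these `d, L`, every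
two region towers `R, R₀` (`K ≦ K_P`) and level `1 ≦ k = j + 1 < K_P` with `L^kε ≦ 1`, `Λ_k = R.block j ⊆ Λ⁰_k = R₀.block j` both unions
of blocks, every `A` with one-step differences `≦ δ_A` on `Ω₀` and `L^kδ_A·|e| ≦ t₀`, every `Λ ⊂ Λ_k` and all `p = (x, i)`, `q = (x′, i′)`
over `Λ` — with the SAME `(c₁, δ₁)` —: (2.34) `|C^{(k)}_Λ(Ω♯, A)(p, q)| ≦ (L^kε)²c₁e^{−δ₁|x − x′|}` and (2.36) `|(C^{(k)}_Λ − C^{(k)}_{Λ♯_k})(Ω♯,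
A)(p, q)| ≦ (L^kε)²c₁e^{−δ₁(|x − x′| + dist(x,Λᶜ) + dist(x′,Λᶜ))}` for `Ω♯ = Ω` (`Λ♯_k = Λ_k`) and for `Ω♯ = Ω₀` (`Λ♯_k = Λ⁰_k`), and (2.38)
`|(C^{(k)}_Λ(Ω, A) − C^{(k)}_Λ(Ω₀, A))(p, q)| ≦ (L^kε)²c₁e^{−δ₁(|x − x′| + dist(x, Λ_kᶜ) + dist(x′, Λ_kᶜ))}`.  Assembly of p35 g16's
`prop23_regular_region_small` (for `R` and for `R₀`) and §1, constants merged (`t₀ = min`, `c₁ = max`, `δ₁ = min`).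
[cite: Balaban1982Higgs1, Prop. 2.3 (2.34) p.611, (2.36)–(2.38) p.612, Prop. 2.1 (2.23) p.610]
[cite: Balaban1983RegularityDecay, Sect. 5 (5.4) p.593, (5.5)–(5.6) p.594] -/
theorem prop23_nested_regular_region_small (d L : ℕ) (hL1 : 1 < L) {a msq : ℝ} (ha : 0 < a) (hmsq : 0 < msq) (N : ℕ) :
    ∃ t₀ c₁ δ₁ : ℝ, 0 < t₀ ∧ 0 < c₁ ∧ 0 < δ₁ ∧
      ∀ (C : ChargeData N) (P : HiggsLattice.Params), P.d = d → P.L = L →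
      ∀ {K : ℕ} (R R₀ : Regions P K), K ≤ P.K → ∀ (j : Fin K), j.val + 1 < P.K → P.mesh (j.val + 1) ≤ 1 →
      (∀ y y' : HiggsLattice.Site P (j.val + 1),
        HiggsLattice.blockOf y = HiggsLattice.blockOf y' → (y ∈ R.block j ↔ y' ∈ R.block j)) →
      (∀ y y' : HiggsLattice.Site P (j.val + 1),
        HiggsLattice.blockOf y = HiggsLattice.blockOf y' → (y ∈ R₀.block j ↔ y' ∈ R₀.block j)) →
      R.block j ⊆ R₀.block j →
      ∀ (A : HiggsLattice.VecField P 0) {δA : ℝ}, 0 ≤ δA →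
        (∀ z ∈ pieceF R₀ j, ∀ μ' ν : Fin P.d, |A ⟨z.shift ν, μ'⟩ - A ⟨z, μ'⟩| ≤ δA) →
        (P.L : ℝ) ^ (j.val + 1) * δA * |C.e| ≤ t₀ →
        ∀ {Λ : Finset (HiggsLattice.Site P (j.val + 1))}, Λ ⊆ R.block j →
        ∀ {p q : HiggsLattice.Site P (j.val + 1) × Ix N}, p.1 ∈ Λ → q.1 ∈ Λ →
          (|mat (condCov232 C (pieceF R j) A msq a (j.val + 1) Λ) p q| ≤
              P.mesh (j.val + 1) ^ 2 * c₁ * Real.exp (-(δ₁ * (HiggsLattice.Site.tdist p.1 q.1 : ℝ)))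
            ∧ |mat (condCov232 C (pieceF R j) A msq a (j.val + 1) Λ) p q
                  - mat (condCov232 C (pieceF R j) A msq a (j.val + 1) (R.block j)) p q| ≤
                P.mesh (j.val + 1) ^ 2 * c₁ * Real.exp (-(δ₁ *
                  ((HiggsLattice.Site.tdist p.1 q.1 : ℝ) + distC Λ p.1 + distC Λ q.1))))
          ∧ (|mat (condCov232 C (pieceF R₀ j) A msq a (j.val + 1) Λ) p q| ≤
              P.mesh (j.val + 1) ^ 2 * c₁ * Real.exp (-(δ₁ * (HiggsLattice.Site.tdist p.1 q.1 : ℝ)))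
            ∧ |mat (condCov232 C (pieceF R₀ j) A msq a (j.val + 1) Λ) p q
                  - mat (condCov232 C (pieceF R₀ j) A msq a (j.val + 1) (R₀.block j)) p q| ≤
                P.mesh (j.val + 1) ^ 2 * c₁ * Real.exp (-(δ₁ *
                  ((HiggsLattice.Site.tdist p.1 q.1 : ℝ) + distC Λ p.1 + distC Λ q.1))))
          ∧ |mat (condCov232 C (pieceF R j) A msq a (j.val + 1) Λ) p q
                - mat (condCov232 C (pieceF R₀ j) A msq a (j.val + 1) Λ) p q| ≤
              P.mesh (j.val + 1) ^ 2 * c₁ * Real.exp (-(δ₁ *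
                ((HiggsLattice.Site.tdist p.1 q.1 : ℝ) + distC (R.block j) p.1 + distC (R.block j) q.1))) := by
  obtain ⟨t₁, c₁, δ₁, ht₁, hc₁, hδ₁, h₁⟩ := prop23_regular_region_small d L hL1 ha hmsq N
  obtain ⟨t₂, c₂, δ₂, ht₂, hc₂, hδ₂, h₂⟩ := prop23_238_regular_region_small d L hL1 ha hmsq N
  refine ⟨min t₁ t₂, max c₁ c₂, min δ₁ δ₂, lt_min ht₁ ht₂, lt_max_of_lt_left hc₁, lt_min hδ₁ hδ₂, ?_⟩
  intro C P hPd hPL K R R₀ hK j hjK hs hU hU₀ hsubΛ A δA hδA hreg₀ ht Λ hΛ p q hp hq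
  have ht1 : (P.L : ℝ) ^ (j.val + 1) * δA * |C.e| ≤ t₁ := ht.trans (min_le_left _ _)
  have ht2 : (P.L : ℝ) ^ (j.val + 1) * δA * |C.e| ≤ t₂ := ht.trans (min_le_right _ _)
  -- regularity on `Ω ⊆ Ω₀`
  have hsubΩ : pieceF R j ⊆ pieceF R₀ j := by
    intro x hx
    rw [mem_pieceF_iff] at hx ⊢
    exact hsubΛ hx
  have hreg : ∀ z ∈ pieceF R j, ∀ μ' ν : Fin P.d, |A ⟨z.shift ν, μ'⟩ - A ⟨z, μ'⟩| ≤ δA :=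
    fun z hz => hreg₀ z (hsubΩ hz)
  obtain ⟨hA1, hA2⟩ := h₁ C P hPd hPL R hK j hjK hs hU A hδA hreg ht1 hΛ hp hq
  obtain ⟨hB1, hB2⟩ := h₁ C P hPd hPL R₀ hK j hjK hs hU₀ A hδA hreg₀ ht1 (hΛ.trans hsubΛ) hp hq
  have hD := h₂ C P hPd hPL R R₀ hK j hjK hs hU hU₀ hsubΛ A hδA hreg₀ ht2 hΛ hp hq
  have hm : 0 ≤ P.mesh (j.val + 1) ^ 2 := sq_nonneg _
  have ht : 0 ≤ (HiggsLattice.Site.tdist p.1 q.1 : ℝ) := Nat.cast_nonneg _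
  have htΛ : 0 ≤ (HiggsLattice.Site.tdist p.1 q.1 : ℝ) + distC Λ p.1 + distC Λ q.1 :=
    add_nonneg (add_nonneg ht (distC_nonneg _ _)) (distC_nonneg _ _)
  have htR : 0 ≤ (HiggsLattice.Site.tdist p.1 q.1 : ℝ) + distC (R.block j) p.1 + distC (R.block j) q.1 :=
    add_nonneg (add_nonneg ht (distC_nonneg _ _)) (distC_nonneg _ _)
  refine ⟨⟨?_, ?_⟩, ⟨?_, ?_⟩, ?_⟩
  · exact kernelBound_weaken hm hc₁.le (le_max_left _ _) (min_le_left _ _) ht hA1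
  · exact kernelBound_weaken hm hc₁.le (le_max_left _ _) (min_le_left _ _) htΛ hA2
  · exact kernelBound_weaken hm hc₁.le (le_max_left _ _) (min_le_left _ _) ht hB1
  · exact kernelBound_weaken hm hc₁.le (le_max_left _ _) (min_le_left _ _) htΛ hB2
  · exact kernelBound_weaken hm hc₂.le (le_max_right _ _) (min_le_right _ _) htR hD

end Joint

end Literature.MathematicalPhysics.QuantumFieldTheory.Balaban1983to89.B1Ineq238RegularRegionSmall

end
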